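import Summits.BirchSwinnertonDyer.BirchSwinnertonDyer.Theses.GenusKolyvaginAtTwo
import Literature.NumberTheory.EllipticCurves.LeadingTerm
import Literature.NumberTheory.EllipticCurves.BSDRankZeroDensityProofs
import Literature.NumberTheory.EllipticCurves.TwoIsogenyShaTwoTorsion
import HarnessLib

/-!
# Crux `MinimalTwinBSDTwo` (route `GenusKolyvaginAtTwo`, item stmt-BirchSwinnertonDyer-22985): the STRUCTURE of a
# `2`-Selmer-minimal curve of analytic rank one, and the reduction of the crux to ONE `2`-adic unit statement

Cell `bsd-f1-sign2`, seat `bsd-line-gk2-p2` (prover seat 2/3 on D-0145 line `route-BirchSwinnertonDyer-GenusKolyvaginAtTwo`,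
route DRAFT rev 2). SUPPORT file for the crux
`Summit.BirchSwinnertonDyer.BirchSwinnertonDyer.Theses.GenusKolyvaginAtTwo.MinimalTwinBSDTwo`
(«BSD₂ for non-CM `W/ℚ` of analytic rank `1` with `#Sel₂(W) = 2`» — the rank-one input the route's glue consumes for the
`2`-Selmer-minimal twin `E^{(d_K)}`). HONEST FRAMING: BSD is not proved by any of this, and the crux stays OPEN: what is
proved here is bookkeeping from PUBLISHED inputs, isolating the single statement that is NOT in print.

## What is proved (sorry-free; the only named fact used is Gross–Zagier–Kolyvagin, as the hypothesis `hGZK`)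

* `natCard_torsionBy_eq_one_and_natCard_shaTwo_eq_one` — UNCONDITIONAL: `#Sel^{(2)}(W/ℚ) = 2` and `rank W(ℚ) = 1` force
  `E(ℚ)[2] = 0` and `Ш(W/ℚ)[2] = 0`, by the exact descent count `#Sel^{(2)} = 2^{rank} · #E(ℚ)[2] · #Ш[2]`
  (Silverman AEC X.4.2, tree theorem `WeierstrassCurve.natCard_selmerGroup_eq`).
* `structure_of_card_selmerGroup_two` — granted GZK (`rank_eq_analyticRank_of_analyticRank_le_one`, bsd.S17, Darmon 2004
  Thm. 3.22): a curve with `r_an(W) = 1` and `#Sel₂(W) = 2` has `rank W(ℚ) = 1`, `E(ℚ)[2] = 0`, `Ш(W/ℚ)[2] = 0`, hence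
  `Ш(W/ℚ)[2^∞] = 0` (finite, of order `1`), and Miller's `BSD(W,2)` (`BSDp W 2`, Miller 2011 Def. 1.1) is EQUIVALENT to
  «`#Ш_an(W)` is a rational `2`-adic unit»: `∃ r : ℚ, shaAn W = r ∧ ord₂ r = 0`.
* `minimalTwinBSDTwo_of_gzk_of_unit` — THE REDUCTION: GZK ∧ (U₂) ⟹ `MinimalTwinBSDTwo` BY NAME, where (U₂) is the
  `2`-adic unit statement on exactly the crux's class (binders of the crux plus the three derived facts rank `1`,
  `E(ℚ)[2] = 0`, `Ш[2^∞] = 0` as free extra hypotheses): for `W/ℚ` globally minimal, non-CM, `r_an = 1`, `#Sel₂ = 2`,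
  `#Ш_an(W) = L'(W,1)·#W(ℚ)_tors² / (Ω_W · ∏_p c_p · Reg W)` is a rational number of `2`-adic valuation `0`.
* `unit_of_gzk_of_minimalTwinBSDTwo` — the converse bookkeeping: GZK ∧ `MinimalTwinBSDTwo` ⟹ (U₂). So, granted GZK, the
  crux IS (U₂): the reduction loses nothing, and (U₂) is the line's single honest stub (`stub_shaAnUnit` of the skeleton
  `Cruxes/MinimalTwinBSDTwo/Lines/gzkunit.lean`).
* `shaAnUnit_of_bsdTriple` (§4, appended) — misstatement guard: RANK ∧ SHAFIN ∧ LEAD for `W` (`W.BSDTriple`) with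
  `r_an = 1`, `#Sel₂ = 2` implies (U₂)(W) unconditionally; the stub is a consequence of BSD itself, not an artefact.

## Why (U₂) is the research content (placement)

With `Ш(W)[2^∞] = 0` and `#W(ℚ)_tors` odd, (U₂) reads `ord₂ (L'(W,1) / (Ω_W · ĥ-Reg W)) = ord₂ ∏_p c_p(W)`: the `2`-PART of
the Birch–Swinnerton-Dyer formula in analytic rank one. In print the `p`-part of BSD in analytic rank one is known for
`p` ODD under image / reduction hypotheses (Jetchev–Skinner–Wan 2017; Castella 2018; Burungale–Skinner–Tian–Wan 2024,
«Throughout `p ≥ 3`»; CM: Li–Tian–Yan–Zhu 2025), and at `p = 2` only for explicit twist families of a fixed curve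
(Coates–Li–Tian–Zhai 2015, Cai–Li–Zhai 2020: `X₀(49)`, `X₀(36)`, congruent numbers) — never for a general non-CM curve.
The route's own foreseen derivation («KolyvaginExactAtTwo at `M₀ = 0` for the twin's Heegner field + `2`-primitivity of
`y_K` + rank-one Gross–Zagier bookkeeping», Theses docstring) is a path to (U₂), not a proof in print.
presearch (2026-08-27): lit search --hybrid «2-part BSD analytic rank one Gross–Zagier Heegner index Tamagawa» (10 docs:
li2025 = CM only; cornell1997/silverman2009/delbourgo2008 background); lit vsearch (same, prose; 10 docs, no p = 2 rank-1
theorem); lit galaxy search «2-part of the Birch|2-part of BSD|even part of the Birch» --star all (1 noise row);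
arXiv:2409.01350 p. 12 «Throughout p ≥ 3 will be an odd prime». ⇒ none in print for the general non-CM case.

References: J. H. Silverman, AEC 2nd ed. (2009) Thm. X.4.2 [SilvermanAEC2009]; H. Darmon, *Rational points on modular
elliptic curves* (2004) Thm. 3.22 [Darmon2004]; R. L. Miller, LMS J. Comput. Math. 14 (2011) Def. 1.1 [Miller2011LMS];
D. Jetchev, C. Skinner, X. Wan, Camb. J. Math. 5 (2017) [JetchevSkinnerWan2017]; A. Burungale, C. Skinner, Y. Tian, X. Wan,
arXiv:2409.01350 (2024) [BurungaleSkinnerTianWan2024]; J. Coates, Y. Li, Y. Tian, S. Zhai, PLMS 110 (2015)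
[CoatesLiTianZhai2015].
-/

set_option autoImplicit false
set_option linter.dupNamespace false -- `Summit.BirchSwinnertonDyer.BirchSwinnertonDyer.…` is the tree's layout (D-0017)

noncomputable section

open scoped Classical

namespace Summit.BirchSwinnertonDyer.BirchSwinnertonDyer.Theorems.MinimalTwinBSDTwo

open WeierstrassCurve Literature.NumberTheory.EllipticCurves

/-! ## §1 The descent count at `#Sel₂ = 2` (unconditional) -/

/-- **`#Sel^{(2)}(W/ℚ) = 2` and `rank W(ℚ) = 1` force `#E(ℚ)[2] = 1` and `#Ш(W/ℚ)[2] = 1`.** From the exact descent count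
`#Sel^{(2)} = 2^{rank} · #E(ℚ)[2] · #(Ш ⊓ H¹(ℚ,E)[2])` (Silverman AEC X.4.2(a); tree `natCard_selmerGroup_eq`):
`2 = 2 · #E(ℚ)[2] · #Ш[2]`. Unconditional. [cite: SilvermanAEC2009, Thm. X.4.2(a)] -/
theorem natCard_torsionBy_eq_one_and_natCard_shaTwo_eq_one (W : WeierstrassCurve ℚ) [W.IsElliptic]
    (hSel : Nat.card (W.selmerGroup 2) = 2) (hrank : W.mordellWeilRank = 1) :
    Nat.card (AddSubgroup.torsionBy W.toAffine.Point (2 : ℤ)) = 1 ∧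
      Nat.card (W.sha ⊓ AddSubgroup.torsionBy W.galH1 (2 : ℤ) : AddSubgroup W.galH1) = 1 := by
  have hcard := W.natCard_selmerGroup_eq (n := 2) two_ne_zero
  simp only [Nat.cast_ofNat] at hcard
  rw [hSel, hrank, pow_one, mul_assoc] at hcard
  have h : Nat.card (AddSubgroup.torsionBy W.toAffine.Point (2 : ℤ)) *
      Nat.card (W.sha ⊓ AddSubgroup.torsionBy W.galH1 (2 : ℤ) : AddSubgroup W.galH1) = 1 :=
    Nat.eq_of_mul_eq_mul_left two_pos (by rw [mul_one]; convert hcard.symm)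
  exact ⟨Nat.eq_one_of_mul_eq_one_right h, Nat.eq_one_of_mul_eq_one_left h⟩

/-- **`Ш(W/ℚ) ⊓ H¹(ℚ,E)[2] = ⊥` ⟹ `Ш` has no `2`-torsion** (membership form). [folklore] -/
theorem forall_mem_sha_two_smul (W : WeierstrassCurve ℚ)
    (h : (W.sha ⊓ AddSubgroup.torsionBy W.galH1 (2 : ℤ) : AddSubgroup W.galH1) = ⊥) :
    ∀ c ∈ W.sha, 2 • c = 0 → c = 0 := by
  intro c hc h2
  have hmem : c ∈ (W.sha ⊓ AddSubgroup.torsionBy W.galH1 (2 : ℤ) : AddSubgroup W.galH1) :=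
    AddSubgroup.mem_inf.mpr ⟨hc, (AddSubgroup.torsionBy.nsmul_iff (n := 2)).mpr h2⟩
  rw [h] at hmem
  exact AddSubgroup.mem_bot.mp hmem

/-! ## §2 The structure theorem, granted Gross–Zagier–Kolyvagin -/

/-- **Structure of a `2`-Selmer-minimal curve of analytic rank one, granted GZK.** If `r_an(W) = 1` and
`#Sel^{(2)}(W/ℚ) = 2` then: `rank W(ℚ) = 1` (GZK, Darmon 2004 Thm. 3.22, hypothesis `hGZK`); `#E(ℚ)[2] = 1` and
`#Ш(W/ℚ)[2] = 1` (descent count, Silverman X.4.2); `Ш(W/ℚ)[2^∞] = ⊥` (a `2`-primary group without `2`-torsion is trivial);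
and Miller's `BSD(W,2)` is equivalent to «`#Ш_an(W)` is a rational number of `2`-adic valuation `0`» (its rank clause is
GZK, its finiteness clause holds, and `ord₂ #Ш[2^∞] = ord₂ 1 = 0`). No CM / minimality / image hypothesis is needed for
this bookkeeping. [cite: Darmon2004, Thm. 3.22] [cite: SilvermanAEC2009, Thm. X.4.2(a)] [cite: Miller2011LMS, Def. 1.1] -/
theorem structure_of_card_selmerGroup_two (hGZK : rank_eq_analyticRank_of_analyticRank_le_one)
    (W : WeierstrassCurve ℚ) [W.IsElliptic] (har : W.analyticRank = 1) (hSel : Nat.card (W.selmerGroup 2) = 2) :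
    W.mordellWeilRank = 1 ∧ Nat.card (AddSubgroup.torsionBy W.toAffine.Point (2 : ℤ)) = 1 ∧
      (W.sha ⊓ AddSubgroup.torsionBy W.galH1 (2 : ℤ) : AddSubgroup W.galH1) = ⊥ ∧
      AddCommGroup.primaryComponent W.sha 2 = ⊥ ∧ Finite (AddCommGroup.primaryComponent W.sha 2) ∧
      (BSDp W 2 ↔ ∃ r : ℚ, shaAn W = (r : ℂ) ∧ padicValRat 2 r = 0) := by
  -- GZK: rank = r_an = 1
  have hra : W.mordellWeilRank = W.analyticRank := (hGZK W (by rw [har])).1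
  have hrank : W.mordellWeilRank = 1 := hra.trans har
  -- descent count: `#E(ℚ)[2] = 1`, `#Ш[2] = 1`
  obtain ⟨htors, hsha2⟩ := natCard_torsionBy_eq_one_and_natCard_shaTwo_eq_one W hSel hrank
  have hinf : (W.sha ⊓ AddSubgroup.torsionBy W.galH1 (2 : ℤ) : AddSubgroup W.galH1) = ⊥ :=
    AddSubgroup.eq_bot_of_card_eq _ hsha2
  -- `Ш[2^∞] = ⊥`, finite of order `1`
  have hbot : AddCommGroup.primaryComponent W.sha 2 = ⊥ :=
    W.primaryComponent_sha_eq_bot_of_forall (forall_mem_sha_two_smul W hinf)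
  have hfin : Finite (AddCommGroup.primaryComponent W.sha 2) := by rw [hbot]; infer_instance
  have hcard : Nat.card (AddCommGroup.primaryComponent W.sha 2) = 1 := by rw [hbot]; exact AddSubgroup.card_bot
  refine ⟨hrank, htors, hinf, hbot, hfin, ?_⟩
  rw [bsdp_iff]
  simp only [hra, hfin, hcard, padicValNat_one_right, Nat.cast_zero, true_and]

/-! ## §3 The reduction of the crux to the `2`-adic unit statement (U₂), and its converse -/

/-- **THE REDUCTION: GZK ∧ (U₂) ⟹ `MinimalTwinBSDTwo` BY NAME.** Here `hU` is (U₂), the line's single stub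
(`stub_shaAnUnit`): on the crux's binders (`W/ℚ` elliptic, globally minimal, non-CM, `r_an(W) = 1`, `#Sel₂(W) = 2`) and
given, for free, the three consequences of §2 (`rank W(ℚ) = 1`, `#E(ℚ)[2] = 1`, `Ш(W/ℚ)[2^∞] = ⊥`), the analytic order of
`Ш`, `#Ш_an(W) = L'(W,1)·#W(ℚ)_tors² / (Ω_W · ∏_p c_p · Reg W)` (`shaAn`, Miller 2011 §1), is a rational `2`-adic unit.
Proof: §2 turns `BSDp W 2` into exactly that. BSD is not proved by this; (U₂) is NOT in print (module docstring).
[cite: Miller2011LMS, Def. 1.1] [cite: Darmon2004, Thm. 3.22] -/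
theorem minimalTwinBSDTwo_of_gzk_of_unit (hGZK : rank_eq_analyticRank_of_analyticRank_le_one)
    (hU : ∀ (W : WeierstrassCurve ℚ) [W.IsElliptic] [W.IsGloballyMinimal], ¬ W.HasCM → W.analyticRank = 1 →
      Nat.card (W.selmerGroup 2) = 2 → W.mordellWeilRank = 1 →
      Nat.card (AddSubgroup.torsionBy W.toAffine.Point (2 : ℤ)) = 1 →
      AddCommGroup.primaryComponent W.sha 2 = ⊥ →
      ∃ r : ℚ, shaAn W = (r : ℂ) ∧ padicValRat 2 r = 0) :
    Summit.BirchSwinnertonDyer.BirchSwinnertonDyer.Theses.GenusKolyvaginAtTwo.MinimalTwinBSDTwo := by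
  intro W _ _ hcm har hSel
  obtain ⟨hrank, htors, -, hbot, -, hiff⟩ := structure_of_card_selmerGroup_two hGZK W har hSel
  exact hiff.mpr (hU W hcm har hSel hrank htors hbot)

/-- **The converse bookkeeping: GZK ∧ `MinimalTwinBSDTwo` ⟹ (U₂).** So, granted GZK, the crux and the stub (U₂) are
EQUIVALENT — the skeleton's reduction loses nothing. [cite: Miller2011LMS, Def. 1.1] [cite: Darmon2004, Thm. 3.22] -/
theorem unit_of_gzk_of_minimalTwinBSDTwo (hGZK : rank_eq_analyticRank_of_analyticRank_le_one)
    (h : Summit.BirchSwinnertonDyer.BirchSwinnertonDyer.Theses.GenusKolyvaginAtTwo.MinimalTwinBSDTwo) :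
    ∀ (W : WeierstrassCurve ℚ) [W.IsElliptic] [W.IsGloballyMinimal], ¬ W.HasCM → W.analyticRank = 1 →
      Nat.card (W.selmerGroup 2) = 2 → W.mordellWeilRank = 1 →
      Nat.card (AddSubgroup.torsionBy W.toAffine.Point (2 : ℤ)) = 1 →
      AddCommGroup.primaryComponent W.sha 2 = ⊥ →
      ∃ r : ℚ, shaAn W = (r : ℂ) ∧ padicValRat 2 r = 0 := by
  intro W _ _ hcm har hSel _ _ _
  exact (structure_of_card_selmerGroup_two hGZK W har hSel).2.2.2.2.2.mp (h W hcm har hSel)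

/-! ## §4 Misstatement guard: (U₂) is a CONSEQUENCE of the Birch–Swinnerton-Dyer conjecture for `W`

(Appended by the same seat, same session.) The stub (U₂) is not an artefact of Miller's `ord_p` currency: for a curve
with `r_an(W) = 1` and `#Sel₂(W) = 2`, RANK ∧ SHAFIN ∧ LEAD for `W` (`W.BSDTriple`, the full BSD conjecture for `W`)
implies (U₂)(W) — unconditionally, no GZK needed (the rank clause of `BSDTriple` replaces it). So (U₂) is exactly as
hard as, and refutable only together with, BSD itself on this class; in particular no «stray `2`-power» can make the
stub false while BSD holds (contrast the route's worry for `ExactDescentAtTwo`). -/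

/-- **(U₂) ⟸ BSD(`W`).** If `W/ℚ` satisfies RANK ∧ SHAFIN ∧ LEAD (`W.BSDTriple`), has analytic rank `1` and
`#Sel^{(2)}(W/ℚ) = 2`, then `#Ш_an(W)` is a rational `2`-adic unit: by RANK, `rank W(ℚ) = 1`; by the descent count
(§1) `Ш(W/ℚ)[2] = 0`, so `Ш[2^∞] = ⊥` has order `1`; and BSD gives Miller's `BSD(W,2)` (tree
`forall_bsdp_of_bsdTriple`, Miller 2011 §1), whose valuation clause now reads `ord₂ #Ш_an(W) = ord₂ 1 = 0`.
[cite: Miller2011LMS, §1 and Def. 1.1] [cite: SilvermanAEC2009, Thm. X.4.2(a)] -/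
theorem shaAnUnit_of_bsdTriple (W : WeierstrassCurve ℚ) [W.IsElliptic] (hBSD : W.BSDTriple)
    (har : W.analyticRank = 1) (hSel : Nat.card (W.selmerGroup 2) = 2) :
    ∃ r : ℚ, shaAn W = (r : ℂ) ∧ padicValRat 2 r = 0 := by
  have hra : W.mordellWeilRank = W.analyticRank := (show W.analyticRank = W.mordellWeilRank from hBSD.1).symm
  have hrank : W.mordellWeilRank = 1 := hra.trans har
  obtain ⟨-, hsha2⟩ := natCard_torsionBy_eq_one_and_natCard_shaTwo_eq_one W hSel hrank
  have hbot : AddCommGroup.primaryComponent W.sha 2 = ⊥ :=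
    W.primaryComponent_sha_eq_bot_of_forall
      (forall_mem_sha_two_smul W (AddSubgroup.eq_bot_of_card_eq _ hsha2))
  have hcard : Nat.card (AddCommGroup.primaryComponent W.sha 2) = 1 := by
    rw [hbot]; exact AddSubgroup.card_bot
  obtain ⟨-, -, q, hq, hv⟩ := forall_bsdp_of_bsdTriple W W.tamagawaProduct_pos_holds hBSD 2 Nat.prime_two
  refine ⟨q, hq, ?_⟩
  rw [hv, hcard]
  simp

end Summit.BirchSwinnertonDyer.BirchSwinnertonDyer.Theorems.MinimalTwinBSDTwo

end
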